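import Literature.RepresentationTheory.HeisenbergGroup.SchrodingerDirectSum
import Literature.NumberTheory.Automorphic.LocalSchwartzBruhatBoxScalarFunctional
import HarnessLib

/-!
# The doubling principle for a first-factor quotient scalar: a Lagrangian-invariant functional on `𝒮(K^ι) = 𝒮(K^{ι₁}) ⊠ 𝒮(K^{ι₂})`
# reads off the scalar by which an operator acts on the `𝒴`-coinvariants of the first factor

Topic `RepresentationTheory/HeisenbergGroup`; namespace `Literature.RepresentationTheory.HeisenbergGroup` (that of ★ `SchrodingerDirectSum`).
KERNEL MATHEMATICS ONLY (theorems; no `def`, no named fact, no instance, no notation, no `sorry`).  Cell `hodgecm-mathlib` (D-0151),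
programme P2, N3 ROAD NOTE v2 (`F0/P2/B-p18/g28/N3-ROAD.v2.B-p18g28.md` §2 «STATUS AT SEAT CLOSE») brick **(D3d), GENERIC HALF**: the
pure representation-theoretic skeleton of «`λ′ := ev₀ ∘ r(δ′) ∘ ω^𝔻(w₀)` kills the `((Y ⊕ 0) ⊗ W)`-relations, `m(α) ⊕ 1 ↦ ω(s_v m(α)) ⊠ 1` by undoubling,
Schur gives `ω(s_v m(α))|_{S_Y} = c(α)`, and `λ′ ≠ 0` on some `f₁ ⊠ f₂` forces `c(α) =` the `P_{Δ′}`-eigenvalue», with every Weil-representation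
input turned into a HYPOTHESIS.  What is NOT here: the CM inputs themselves (the Schur scalar for `m(α)`, the eigen-law of `λ′`, its non-vanishing,
the undoubling identity ★ `omegaLoc_inlLoc_boxSB` at the CM package) — those are the remaining (D3d) bricks in the doubled CM currency.

SETTING (★ `SchrodingerDirectSum` §3): `K` a non-archimedean local field, `e : ι₁ ⊕ ι₂ ≃ ι`, Gram matrices `T₁, T₂` and `T = reindex e e (T₁ ⊕ T₂)`
(`hT`), `ψ` locally constant; `ρ = schrodingerSB β_T ψ` on `𝒮(K^ι)`, `ρ₁ = schrodingerSB β_{T₁} ψ` on `𝒮(K^{ι₁})`, the embedding ★ `inlH : H(W_{T₁}) →* H(W_T)`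
with ★ `schrodingerSB_inlH_boxSB : ρ(inlH h₁)(f₁ ⊠ f₂) = ρ₁(h₁) f₁ ⊠ f₂`.  DATA: a set `𝒴` of elements of `H(W_{T₁})` («the Lagrangian `Y ⊗ W` of the first
summand»); the span `U(𝒴)` of the `𝒴`-coboundaries `ρ₁(y) f − f` («the `Y`-coinvariant kernel», ★ p830834's `ker φ₀` in an adapted model); a linear
operator `T_A` of `𝒮(K^{ι₁})` acting on `𝒮(K^{ι₁}) ⧸ U(𝒴)` by a scalar `c` (`T_A f − c • f ∈ U(𝒴)`, Schur's output); a linear operator `T_C` of `𝒮(K^ι)` with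
`T_C (f₁ ⊠ f₂) = (T_A f₁) ⊠ f₂` (the undoubling identity); a linear functional `lam` on `𝒮(K^ι)` INVARIANT under `ρ(inlH y)`, `y ∈ 𝒴` (a
`Δ′ ⊗ W`-coinvariant functional with `Y ⊕ 0 ⊂ Δ′`), with the eigen-law `lam (T_C Φ) = c′ · lam Φ` and `lam ≠ 0`.

* §1 `apply_boxSB_sub_eq_zero_of_invariant` — `lam ((ρ₁(y) f − f) ⊠ f₂) = 0` for `y ∈ 𝒴` (★ `schrodingerSB_inlH_boxSB` + invariance);
  `apply_boxSB_eq_zero_of_mem_span` — hence `lam (u ⊠ f₂) = 0` for every `u ∈ U(𝒴)` (span induction; `⊠` is linear in the first slot).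
* §2 `eq_sumEndSB_of_apply_boxSB` — an operator agreeing with `T_A ⊠ 1` on products IS ★ `sumEndSB K e T_A 1` (★ `linearMap_ext_boxSB`).
* §3 **`quotientScalar_eq_of_invariant_functional`** — THE DOUBLING PRINCIPLE: under the data above, `c′ = c` (★ p834000
  `eq_of_comp_sumEndSB_id_eq_smul`); product-only form `quotientScalar_eq_of_invariant_functional'` (eigen-law and non-vanishing given on ONE
  product `f₁ ⊠ f₂`); and the forward identity `apply_TC_boxSB_eq_mul` (`lam (T_C (f₁ ⊠ f₂)) = c · lam (f₁ ⊠ f₂)`, no eigen-law needed).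

[MoeglinVignerasWaldspurger1987, Chap. 2 II.1 Rem. (6) (product operators), Chap. 3 §IV.5 (Jacquet modules of Weil representations via Lagrangian
coinvariants)]; [Kudla1994, §2–§3] (the doubling method behind (D3)).  HC_CM is proved only modulo the printed citations until rung 0 closes;
count-neutral helper.

## References
* [MoeglinVignerasWaldspurger1987] C. Mœglin, M.-F. Vignéras, J.-L. Waldspurger, LNM 1291 (1987), Chap. 2 I.4 Exemple (1), II.1 Rem. (6); Chap. 3 §IV.5.
* [Kudla1994] S. Kudla, Israel J. Math. 87 (1994), §2 (doubled space), §3 Thm. 3.1.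
-/

set_option autoImplicit false

noncomputable section

open scoped TensorProduct

namespace Literature.RepresentationTheory.HeisenbergGroup

open Literature.NumberTheory.Automorphic
open Literature.NumberTheory.GaloisRepresentations.IsNonarchimedeanLocalField

variable {K : Type*} [Field K] [ValuativeRel K] [TopologicalSpace K] [IsNonarchimedeanLocalField K]
  {ι₁ ι₂ ι : Type*} [Fintype ι₁] [Fintype ι₂] [Fintype ι] [DecidableEq ι₁] [DecidableEq ι₂] [DecidableEq ι]
  (e : ι₁ ⊕ ι₂ ≃ ι) (T₁ : Matrix ι₁ ι₁ K) (T₂ : Matrix ι₂ ι₂ K) {T : Matrix ι ι K}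
  (hT : T = Matrix.reindex e e (Matrix.fromBlocks T₁ 0 0 T₂))
  {ψ : AddChar K Circle} (hl : IsLocallyConstant (⇑ψ : K → Circle))
  (hb₁ : ∀ y : ι₁ → K, Continuous fun u : ι₁ → K => Matrix.toLinearMap₂' K T₁ u y)
  (hb : ∀ y : ι → K, Continuous fun u : ι → K => Matrix.toLinearMap₂' K T u y)
  (𝒴 : Set (Heisenberg (polar (Matrix.toLinearMap₂' K T₁))))
  (lam : SchwartzBruhat (ι → K) →ₗ[ℂ] ℂ)

/-! ## §1 An `inlH(𝒴)`-invariant functional kills the first-factor `𝒴`-coboundaries -/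

/-- **`lam ((ρ₁(y) f − f) ⊠ f₂) = 0`** for a functional invariant under `ρ(inlH y)`: by ★ `schrodingerSB_inlH_boxSB`,
`(ρ₁(y) f) ⊠ f₂ = ρ(inlH y)(f ⊠ f₂)`. [cite: MoeglinVignerasWaldspurger1987, Chap. 2 I.4 Exemple (1)] -/
theorem apply_boxSB_sub_eq_zero_of_invariant
    (hlam : ∀ y ∈ 𝒴, ∀ Φ : SchwartzBruhat (ι → K),
      lam (schrodingerSB (Matrix.toLinearMap₂' K T) ψ hl hb (inlH e T₁ T₂ hT y) Φ) = lam Φ)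
    {y : Heisenberg (polar (Matrix.toLinearMap₂' K T₁))} (hy : y ∈ 𝒴) (f : SchwartzBruhat (ι₁ → K)) (f₂ : SchwartzBruhat (ι₂ → K)) :
    lam (boxSB K e (schrodingerSB (Matrix.toLinearMap₂' K T₁) ψ hl hb₁ y f - f) f₂) = 0 := by
  have hsub : boxSB K e (schrodingerSB (Matrix.toLinearMap₂' K T₁) ψ hl hb₁ y f - f) f₂ =
      boxSB K e (schrodingerSB (Matrix.toLinearMap₂' K T₁) ψ hl hb₁ y f) f₂ - boxSB K e f f₂ := by
    rw [← sumEquivSB_tmul, ← sumEquivSB_tmul, ← sumEquivSB_tmul, TensorProduct.sub_tmul, map_sub]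
  rw [hsub, map_sub, ← schrodingerSB_inlH_boxSB e T₁ T₂ hT hl hb₁ hb y f f₂, hlam y hy, sub_self]

/-- **hence `lam (u ⊠ f₂) = 0` for every `u` in the span `U(𝒴)` of the `𝒴`-coboundaries** (`⊠ f₂` is linear in the first slot).
[cite: MoeglinVignerasWaldspurger1987, Chap. 3 §IV.5] -/
theorem apply_boxSB_eq_zero_of_mem_span
    (hlam : ∀ y ∈ 𝒴, ∀ Φ : SchwartzBruhat (ι → K),
      lam (schrodingerSB (Matrix.toLinearMap₂' K T) ψ hl hb (inlH e T₁ T₂ hT y) Φ) = lam Φ)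
    {u : SchwartzBruhat (ι₁ → K)}
    (hu : u ∈ Submodule.span ℂ {g : SchwartzBruhat (ι₁ → K) |
      ∃ y ∈ 𝒴, ∃ f : SchwartzBruhat (ι₁ → K), g = schrodingerSB (Matrix.toLinearMap₂' K T₁) ψ hl hb₁ y f - f})
    (f₂ : SchwartzBruhat (ι₂ → K)) : lam (boxSB K e u f₂) = 0 := by
  induction hu using Submodule.span_induction with
  | mem g hg =>
    obtain ⟨y, hy, f, rfl⟩ := hg
    exact apply_boxSB_sub_eq_zero_of_invariant e T₁ T₂ hT hl hb₁ hb 𝒴 lam hlam hy f f₂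
  | zero => rw [boxSB_zero_left, map_zero]
  | add u u' _ _ hu hu' => rw [boxSB_add_left, map_add, hu, hu', add_zero]
  | smul a u _ hu => rw [boxSB_smul_left, map_smul, hu, smul_zero]

/-! ## §2 An operator agreeing with `T_A ⊠ 1` on products -/

omit [DecidableEq ι₁] [DecidableEq ι₂] [DecidableEq ι] in
/-- **an operator `T_C` of `𝒮(K^ι)` with `T_C (f₁ ⊠ f₂) = (T_A f₁) ⊠ f₂` IS `T_A ⊠ 1`** (★ `sumEndSB`, ★ `linearMap_ext_boxSB`).
[cite: MoeglinVignerasWaldspurger1987, Chap. 2 II.1 Rem. (6)] -/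
theorem eq_sumEndSB_of_apply_boxSB (TA : SchwartzBruhat (ι₁ → K) →ₗ[ℂ] SchwartzBruhat (ι₁ → K))
    (TC : SchwartzBruhat (ι → K) →ₗ[ℂ] SchwartzBruhat (ι → K))
    (hTC : ∀ (f₁ : SchwartzBruhat (ι₁ → K)) (f₂ : SchwartzBruhat (ι₂ → K)), TC (boxSB K e f₁ f₂) = boxSB K e (TA f₁) f₂) :
    TC = sumEndSB K e TA LinearMap.id :=
  linearMap_ext_boxSB K e fun f₁ f₂ => by rw [hTC, sumEndSB_boxSB, LinearMap.id_apply]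

/-! ## §3 The doubling principle -/

/-- **the forward identity**: for `lam` invariant under `ρ(inlH 𝒴)`, `T_A` acting on `𝒮(K^{ι₁}) ⧸ U(𝒴)` by `c`, and `T_C = T_A ⊠ 1` on products,
`lam (T_C (f₁ ⊠ f₂)) = c · lam (f₁ ⊠ f₂)` — no eigen-law needed (★ p834000 `apply_boxSB_eq_mul_of_sub_smul_mem`).
[cite: MoeglinVignerasWaldspurger1987, Chap. 3 §IV.5] [cite: Kudla1994, §3 Thm. 3.1] -/
theorem apply_TC_boxSB_eq_mul
    (hlam : ∀ y ∈ 𝒴, ∀ Φ : SchwartzBruhat (ι → K),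
      lam (schrodingerSB (Matrix.toLinearMap₂' K T) ψ hl hb (inlH e T₁ T₂ hT y) Φ) = lam Φ)
    (TA : SchwartzBruhat (ι₁ → K) →ₗ[ℂ] SchwartzBruhat (ι₁ → K)) (c : ℂ)
    (hTA : ∀ f : SchwartzBruhat (ι₁ → K), TA f - c • f ∈ Submodule.span ℂ {g : SchwartzBruhat (ι₁ → K) |
      ∃ y ∈ 𝒴, ∃ f : SchwartzBruhat (ι₁ → K), g = schrodingerSB (Matrix.toLinearMap₂' K T₁) ψ hl hb₁ y f - f})
    (TC : SchwartzBruhat (ι → K) →ₗ[ℂ] SchwartzBruhat (ι → K))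
    (hTC : ∀ (f₁ : SchwartzBruhat (ι₁ → K)) (f₂ : SchwartzBruhat (ι₂ → K)), TC (boxSB K e f₁ f₂) = boxSB K e (TA f₁) f₂)
    (f₁ : SchwartzBruhat (ι₁ → K)) (f₂ : SchwartzBruhat (ι₂ → K)) :
    lam (TC (boxSB K e f₁ f₂)) = c * lam (boxSB K e f₁ f₂) := by
  rw [hTC]
  exact apply_boxSB_eq_mul_of_sub_smul_mem K e lam _
    (fun u hu f₂' => apply_boxSB_eq_zero_of_mem_span e T₁ T₂ hT hl hb₁ hb 𝒴 lam hlam hu f₂') TA c hTA f₁ f₂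

/-- **THE DOUBLING PRINCIPLE FOR A FIRST-FACTOR QUOTIENT SCALAR.**  Let `lam ≠ 0` be a linear functional on `𝒮(K^ι) = 𝒮(K^{ι₁}) ⊠ 𝒮(K^{ι₂})`
invariant under `ρ(inlH y)` for `y ∈ 𝒴` and satisfying the eigen-law `lam ∘ T_C = c′ • lam` for an operator `T_C` with `T_C (f₁ ⊠ f₂) = (T_A f₁) ⊠ f₂`,
where `T_A` acts on the `𝒴`-coinvariants `𝒮(K^{ι₁}) ⧸ U(𝒴)` by the scalar `c`.  Then `c′ = c`.  (Road use: `lam = ev₀ ∘ r(δ′) ∘ ω^𝔻(w₀)`,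
`𝒴 = Y ⊗ W`, `T_A = ω(s_v m(α))`, `T_C = ω^𝔻(m(α) ⊕ 1)`, `c′ = μ_w(α)|α|_w^{1/2}`, `c = c(α)` from Schur.)
[cite: Kudla1994, §3 Thm. 3.1] [cite: MoeglinVignerasWaldspurger1987, Chap. 3 §IV.5] -/
theorem quotientScalar_eq_of_invariant_functional
    (hlam : ∀ y ∈ 𝒴, ∀ Φ : SchwartzBruhat (ι → K),
      lam (schrodingerSB (Matrix.toLinearMap₂' K T) ψ hl hb (inlH e T₁ T₂ hT y) Φ) = lam Φ)
    (TA : SchwartzBruhat (ι₁ → K) →ₗ[ℂ] SchwartzBruhat (ι₁ → K)) (c : ℂ)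
    (hTA : ∀ f : SchwartzBruhat (ι₁ → K), TA f - c • f ∈ Submodule.span ℂ {g : SchwartzBruhat (ι₁ → K) |
      ∃ y ∈ 𝒴, ∃ f : SchwartzBruhat (ι₁ → K), g = schrodingerSB (Matrix.toLinearMap₂' K T₁) ψ hl hb₁ y f - f})
    (TC : SchwartzBruhat (ι → K) →ₗ[ℂ] SchwartzBruhat (ι → K))
    (hTC : ∀ (f₁ : SchwartzBruhat (ι₁ → K)) (f₂ : SchwartzBruhat (ι₂ → K)), TC (boxSB K e f₁ f₂) = boxSB K e (TA f₁) f₂)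
    (c' : ℂ) (hc' : ∀ Φ : SchwartzBruhat (ι → K), lam (TC Φ) = c' * lam Φ) (hne : lam ≠ 0) : c' = c := by
  have hTCeq := eq_sumEndSB_of_apply_boxSB e TA TC hTC
  refine eq_of_comp_sumEndSB_id_eq_smul K e lam _
    (fun u hu f₂ => apply_boxSB_eq_zero_of_mem_span e T₁ T₂ hT hl hb₁ hb 𝒴 lam hlam hu f₂) TA c c' hTA ?_ hne
  refine LinearMap.ext fun Φ => ?_
  rw [LinearMap.coe_comp, Function.comp_apply, ← hTCeq, hc', LinearMap.smul_apply, smul_eq_mul]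

/-- **product-only form**: the eigen-law and the non-vanishing need only be known on ONE product `f₁ ⊠ f₂` with `lam (f₁ ⊠ f₂) ≠ 0`.
[cite: Kudla1994, §3 Thm. 3.1] [cite: MoeglinVignerasWaldspurger1987, Chap. 3 §IV.5] -/
theorem quotientScalar_eq_of_invariant_functional'
    (hlam : ∀ y ∈ 𝒴, ∀ Φ : SchwartzBruhat (ι → K),
      lam (schrodingerSB (Matrix.toLinearMap₂' K T) ψ hl hb (inlH e T₁ T₂ hT y) Φ) = lam Φ)
    (TA : SchwartzBruhat (ι₁ → K) →ₗ[ℂ] SchwartzBruhat (ι₁ → K)) (c : ℂ)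
    (hTA : ∀ f : SchwartzBruhat (ι₁ → K), TA f - c • f ∈ Submodule.span ℂ {g : SchwartzBruhat (ι₁ → K) |
      ∃ y ∈ 𝒴, ∃ f : SchwartzBruhat (ι₁ → K), g = schrodingerSB (Matrix.toLinearMap₂' K T₁) ψ hl hb₁ y f - f})
    (TC : SchwartzBruhat (ι → K) →ₗ[ℂ] SchwartzBruhat (ι → K))
    (f₁ : SchwartzBruhat (ι₁ → K)) (f₂ : SchwartzBruhat (ι₂ → K)) (hTC : TC (boxSB K e f₁ f₂) = boxSB K e (TA f₁) f₂)
    (c' : ℂ) (hc' : lam (TC (boxSB K e f₁ f₂)) = c' * lam (boxSB K e f₁ f₂)) (hne : lam (boxSB K e f₁ f₂) ≠ 0) : c' = c := by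
  refine eq_of_apply_boxSB_eq_mul_of_ne_zero K e lam _
    (fun u hu f₂' => apply_boxSB_eq_zero_of_mem_span e T₁ T₂ hT hl hb₁ hb 𝒴 lam hlam hu f₂') TA c c' hTA f₁ f₂ ?_ hne
  rw [← hTC]
  exact hc'

omit [DecidableEq ι₁] [DecidableEq ι₂] [DecidableEq ι] in
/-- **existence of a witnessing product**: a non-zero `lam` is non-zero on some `f₁ ⊠ f₂` (★ p834000 `exists_apply_boxSB_ne_zero`), so the two forms
of the principle are interchangeable. [cite: MoeglinVignerasWaldspurger1987, Chap. 2 II.1 Rem. (6)] -/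
theorem exists_boxSB_witness (hne : lam ≠ 0) :
    ∃ (f₁ : SchwartzBruhat (ι₁ → K)) (f₂ : SchwartzBruhat (ι₂ → K)), lam (boxSB K e f₁ f₂) ≠ 0 :=
  exists_apply_boxSB_ne_zero K e lam hne

end Literature.RepresentationTheory.HeisenbergGroup

end
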